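import Summits.ValiantsHypothesis.ValiantsHypothesis.Theorems.LacunarySymmetroidMatrixDescartesCensusDoorA34Isotropic
import Literature.Computability.AlgebraicComplexity.RealTauKnownCases

/-!
# `MatrixDescartes` census — DOOR A at `(3,4)`: the GAUGE of the isotropic sub-family, its completed squares, and the
# definite-gauge root law (all supports, any number of letters)

HONEST FRAMING.  Object-search cell `pub-symmetroid`, door-A seat `val-sym-door-p3` (g14); helper file beside the OPEN typed
statement `DoorA34 = PosRootLawAt 3 4 18` (route item `Theses.LacunarySymmetroid.DoorA34`, stmt-ValiantsHypothesis-19980), asserted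
nowhere.  Continuation of `…CensusDoorA34Isotropic` (the ISOTROPIC sub-family: real symmetric pencils with a common isotropic vector,
letters `!![a_l, c_l, u_l; c_l, b_l, v_l; u_l, v_l, 0]`, `det = −(A·V² − 2·Cc·U·V + B·U²)` — the cell's located boundary model of the
bulk extremals of `ζ_sym(3,4)`).  With NO hypothesis on the support or on `K`:

* `isoForm_gauge`, `isoLetter_unipotent_congr` — the **GAUGE**: the unipotent congruence `P = !![1,0,0; 0,1,0; p,q,1]` fixes the
  isotropic vector and maps the letter `(a,b,c,u,v)` to `(a + 2pu, b + 2qv, c + pv + qu, u, v)`; the scalar form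
  `a·v² − 2·c·u·v + b·u²` is unchanged (so the `2 × 2` CORE `[[a,c],[c,b]]` of an isotropic pencil is defined only up to this
  two-parameter gauge, while the BORDER `(u,v)` and the determinant are gauge-invariant);
* `isoForm_mul_a`, `isoForm_mul_b`, `isoForm_split` — the **COMPLETED SQUARES** `a·f = (a·v − c·u)² − (c² − a·b)·u²`,
  `b·f = (b·u − c·v)² − (c² − a·b)·v²`, and `f = v·(a·v − c·u) + u·(b·u − c·v)` (`f` the scalar form);
* `iso_disc_nonneg_of_eq_zero(_gauge)` — the **ROOT LOCUS LAW**: at a zero of `f` with non-zero border `(u,v)`, the core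
  discriminant is non-negative IN EVERY GAUGE, `(c + pv + qu)² ≥ (a + 2pu)(b + 2qv)` for all real `p, q` — a det-root of an
  isotropic pencil lies in the closed indefinite locus of EVERY gauged core `(2,K)` pencil;
* `isoForm_pos_of_posDef`, `isoForm_neg_of_negDef`, `isoForm_ne_zero_of_definite_gauge` — the **DEFINITE-POINT DICTIONARY**:
  where some gauged core is definite the determinant does not vanish and has the sign of (minus) that core;
* pencil versions `det_isoLetters_ne_zero_of_definite_gauge`, `border_eq_zero_of_isRoot_of_definite_gauge`, and the
  **DEFINITE-GAUGE ROW** `card_posRoots_isoLetters_le_of_definite_gauge`: an isotropic `(3,K)` pencil that admits ONE gauge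
  `(p,q)` whose core `(2,K)` pencil is definite at every `t > 0` has all its positive det-roots among the common zeros of the
  border nomials `U, V`; if `U` is not the zero polynomial it has at most `K − 1` of them (`≤ 3 < 18` at `K = 4`) — the
  isotropic counterpart of the hyperbolic-sector row `…DoorA34HyperbolicSector`.

Use: the gauge is the freedom every chamber / window argument on the isotropic sub-door must quotient out (the core `(2,K)`
pencil and its discriminant chambers are NOT invariants of the pencil; the border, the determinant and the root set are), and
the definite-gauge row is the one regime where the sub-door closes outright.  Nothing here bounds `ζ_sym(3,4)` or the isotropic
sub-door in general; `DoorA34` stays OPEN; nothing bears on `MatrixDescartes` (stmt-ValiantsHypothesis-18050) or on `VP ≠ VNP` —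
VP≠VNP not moved.

[folklore] Congruence by a unipotent matrix; completing the square in a binary quadratic form; Descartes' bound for a
`K`-nomial (`Literature.Computability.AlgebraicComplexity.card_roots_toFinset_filter_pos_lt_card_support`); elementary.
-/

-- `Summit.ValiantsHypothesis.ValiantsHypothesis.…` repeats a component by the D-0017 layout
-- (single-conjunct summit), which the `dupNamespace` linter flags; the name is mandated.
set_option linter.dupNamespace false

namespace Summit.ValiantsHypothesis.ValiantsHypothesis.Theorems.LacunarySymmetroidMatrixDescartes.Census

open Polynomial Finset
open scoped BigOperators Polynomial Matrix

/-! ## The gauge -/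

/-- **Gauge invariance of the scalar form** (any commutative ring): replacing the core `(a, b, c)` by
`(a + 2pu, b + 2qv, c + pv + qu)` does not change `a·v² − 2·c·u·v + b·u²`. [folklore] -/
theorem isoForm_gauge {R : Type*} [CommRing R] (a b c u v p q : R) :
    (a + 2 * p * u) * v ^ 2 - 2 * (c + p * v + q * u) * u * v + (b + 2 * q * v) * u ^ 2
      = a * v ^ 2 - 2 * c * u * v + b * u ^ 2 := by
  ring

/-- **The gauge is a congruence fixing the isotropic vector**: with the unipotent `P = !![1,0,0; 0,1,0; p,q,1]`,
`Pᵀ · !![a,c,u; c,b,v; u,v,0] · P = !![a + 2pu, c + pv + qu, u; c + pv + qu, b + 2qv, v; u, v, 0]`. [folklore] -/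
theorem isoLetter_unipotent_congr {R : Type*} [CommRing R] (a b c u v p q : R) :
    (!![1, 0, 0; 0, 1, 0; p, q, 1] : Matrix (Fin 3) (Fin 3) R)ᵀ * !![a, c, u; c, b, v; u, v, 0] * !![1, 0, 0; 0, 1, 0; p, q, 1]
      = !![a + 2 * p * u, c + p * v + q * u, u; c + p * v + q * u, b + 2 * q * v, v; u, v, 0] := by
  ext i j
  fin_cases i <;> fin_cases j <;>
    simp [Matrix.mul_apply, Fin.sum_univ_three, Matrix.transpose_apply] <;> ring

/-- The unipotent gauge matrix has determinant `1`, so the gauge does not change the determinant of a letter or of a pencil value.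
[folklore] -/
theorem det_unipotent_gauge {R : Type*} [CommRing R] (p q : R) :
    (!![1, 0, 0; 0, 1, 0; p, q, 1] : Matrix (Fin 3) (Fin 3) R).det = 1 := by
  simp [Matrix.det_fin_three]

/-! ## Completed squares -/

/-- **Completing the square on `a`**: `a·(a v² − 2 c u v + b u²) = (a v − c u)² − (c² − a b)·u²`. [folklore] -/
theorem isoForm_mul_a {R : Type*} [CommRing R] (a b c u v : R) :
    a * (a * v ^ 2 - 2 * c * u * v + b * u ^ 2) = (a * v - c * u) ^ 2 - (c ^ 2 - a * b) * u ^ 2 := by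
  ring

/-- **Completing the square on `b`**: `b·(a v² − 2 c u v + b u²) = (b u − c v)² − (c² − a b)·v²`. [folklore] -/
theorem isoForm_mul_b {R : Type*} [CommRing R] (a b c u v : R) :
    b * (a * v ^ 2 - 2 * c * u * v + b * u ^ 2) = (b * u - c * v) ^ 2 - (c ^ 2 - a * b) * v ^ 2 := by
  ring

/-- **Splitting along the border**: `a v² − 2 c u v + b u² = v·(a v − c u) + u·(b u − c v)` — the scalar form is the pairing of the
border `(v, u)` with its image `(a v − c u, b u − c v)` under the core. [folklore] -/
theorem isoForm_split {R : Type*} [CommRing R] (a b c u v : R) :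
    a * v ^ 2 - 2 * c * u * v + b * u ^ 2 = v * (a * v - c * u) + u * (b * u - c * v) := by
  ring

/-! ## The root locus law and the definite-point dictionary (real scalars) -/

/-- **Root locus law.**  At a zero of the scalar form with non-zero border, the core discriminant is non-negative:
`a v² − 2 c u v + b u² = 0`, `(u, v) ≠ 0` ⇒ `c² − a b ≥ 0` (the core `[[a,c],[c,b]]` has the isotropic vector `(v, −u)`… up to
orientation, so it is not definite). [folklore] -/
theorem iso_disc_nonneg_of_eq_zero {a b c u v : ℝ} (hf : a * v ^ 2 - 2 * c * u * v + b * u ^ 2 = 0)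
    (huv : u ≠ 0 ∨ v ≠ 0) : 0 ≤ c ^ 2 - a * b := by
  rcases huv with hu | hv
  · have hu2 : 0 < u ^ 2 := by positivity
    have key : (c ^ 2 - a * b) * u ^ 2 = (a * v - c * u) ^ 2 := by
      have := isoForm_mul_a a b c u v
      rw [hf, mul_zero] at this
      linarith
    nlinarith [sq_nonneg (a * v - c * u)]
  · have hv2 : 0 < v ^ 2 := by positivity
    have key : (c ^ 2 - a * b) * v ^ 2 = (b * u - c * v) ^ 2 := by
      have := isoForm_mul_b a b c u v
      rw [hf, mul_zero] at this
      linarith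
    nlinarith [sq_nonneg (b * u - c * v)]

/-- **Root locus law, every gauge.**  At a zero of the scalar form with non-zero border, EVERY gauged core is non-definite:
`(c + p v + q u)² ≥ (a + 2 p u)(b + 2 q v)` for all real `p, q`. [folklore] -/
theorem iso_disc_nonneg_of_eq_zero_gauge {a b c u v : ℝ} (hf : a * v ^ 2 - 2 * c * u * v + b * u ^ 2 = 0)
    (huv : u ≠ 0 ∨ v ≠ 0) (p q : ℝ) :
    0 ≤ (c + p * v + q * u) ^ 2 - (a + 2 * p * u) * (b + 2 * q * v) := by
  have hf' : (a + 2 * p * u) * v ^ 2 - 2 * (c + p * v + q * u) * u * v + (b + 2 * q * v) * u ^ 2 = 0 := by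
    rw [isoForm_gauge]; exact hf
  exact iso_disc_nonneg_of_eq_zero hf' huv

/-- **Definite-point dictionary, positive core.**  If the core is positive definite (`a > 0`, `a b − c² > 0`) and the border is
non-zero, the scalar form is positive. [folklore] -/
theorem isoForm_pos_of_posDef {a b c u v : ℝ} (ha : 0 < a) (hdet : 0 < a * b - c ^ 2) (huv : u ≠ 0 ∨ v ≠ 0) :
    0 < a * v ^ 2 - 2 * c * u * v + b * u ^ 2 := by
  have key := isoForm_mul_a a b c u v
  rcases huv with hu | hv
  · have hu2 : 0 < u ^ 2 := by positivity
    have h1 : 0 < a * (a * v ^ 2 - 2 * c * u * v + b * u ^ 2) := by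
      rw [key]; nlinarith [sq_nonneg (a * v - c * u), mul_pos hdet hu2]
    exact (pos_iff_pos_of_mul_pos h1).mp ha
  · by_cases hu : u = 0
    · subst hu
      have hv2 : 0 < v ^ 2 := by positivity
      nlinarith [mul_pos ha hv2]
    · have hu2 : 0 < u ^ 2 := by positivity
      have h1 : 0 < a * (a * v ^ 2 - 2 * c * u * v + b * u ^ 2) := by
        rw [key]; nlinarith [sq_nonneg (a * v - c * u), mul_pos hdet hu2]
      exact (pos_iff_pos_of_mul_pos h1).mp ha

/-- **Definite-point dictionary, negative core.**  If the core is negative definite (`a < 0`, `a b − c² > 0`) and the border is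
non-zero, the scalar form is negative. [folklore] -/
theorem isoForm_neg_of_negDef {a b c u v : ℝ} (ha : a < 0) (hdet : 0 < a * b - c ^ 2) (huv : u ≠ 0 ∨ v ≠ 0) :
    a * v ^ 2 - 2 * c * u * v + b * u ^ 2 < 0 := by
  have h := isoForm_pos_of_posDef (a := -a) (b := -b) (c := -c) (u := u) (v := v) (by linarith)
    (by nlinarith) huv
  nlinarith

/-- **No zero where some gauge is definite.**  If ONE gauged core `(a + 2pu, b + 2qv, c + pv + qu)` is definite (positive
determinant) and the border is non-zero, the scalar form does not vanish. [folklore] -/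
theorem isoForm_ne_zero_of_definite_gauge {a b c u v : ℝ} (huv : u ≠ 0 ∨ v ≠ 0)
    (h : ∃ p q : ℝ, 0 < (a + 2 * p * u) * (b + 2 * q * v) - (c + p * v + q * u) ^ 2) :
    a * v ^ 2 - 2 * c * u * v + b * u ^ 2 ≠ 0 := by
  intro hf
  obtain ⟨p, q, hpq⟩ := h
  have := iso_disc_nonneg_of_eq_zero_gauge hf huv p q
  linarith

/-- **Zero border forces a zero.**  Conversely the scalar form vanishes wherever the border does (`u = v = 0`): the common zeros of
the border nomials are det-roots of every isotropic pencil with that border. [folklore] -/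
theorem isoForm_eq_zero_of_border_eq_zero {R : Type*} [CommRing R] (a b c u v : R) (hu : u = 0) (hv : v = 0) :
    a * v ^ 2 - 2 * c * u * v + b * u ^ 2 = 0 := by
  subst hu; subst hv; ring

/-! ## Pencil versions -/

/-- **The determinant of an isotropic pencil does not vanish at a point where the border is non-zero and some gauged core is
definite.**  Letters `!![a_l, c_l, u_l; c_l, b_l, v_l; u_l, v_l, 0]` on `E : Fin 5 → Fin K → ℝ` (rows `a, b, c, u, v`), any support
`d`; the entry nomials are evaluated at `t`. [folklore] -/
theorem det_isoLetters_ne_zero_of_definite_gauge {K : ℕ} (d : Fin K → ℕ) (E : Fin 5 → Fin K → ℝ) (t : ℝ)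
    (huv : (∑ l, E 3 l * t ^ d l) ≠ 0 ∨ (∑ l, E 4 l * t ^ d l) ≠ 0)
    (h : ∃ p q : ℝ, 0 < ((∑ l, E 0 l * t ^ d l) + 2 * p * (∑ l, E 3 l * t ^ d l))
        * ((∑ l, E 1 l * t ^ d l) + 2 * q * (∑ l, E 4 l * t ^ d l))
        - ((∑ l, E 2 l * t ^ d l) + p * (∑ l, E 4 l * t ^ d l) + q * (∑ l, E 3 l * t ^ d l)) ^ 2) :
    ((∑ l, (X : ℝ[X]) ^ d l • (!![E 0 l, E 2 l, E 3 l; E 2 l, E 1 l, E 4 l; E 3 l, E 4 l, 0] :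
      Matrix (Fin 3) (Fin 3) ℝ).map C).det).eval t ≠ 0 := by
  rw [det_isoLetters_eval, neg_ne_zero]
  exact isoForm_ne_zero_of_definite_gauge huv h

/-- **At a det-root, either the border vanishes or no gauge is definite** (the root locus law for the pencil): if `t` is a root
of the determinant and ONE gauged core is definite at `t`, then `U(t) = V(t) = 0`. [folklore] -/
theorem border_eq_zero_of_isRoot_of_definite_gauge {K : ℕ} (d : Fin K → ℕ) (E : Fin 5 → Fin K → ℝ) (t : ℝ)
    (hroot : ((∑ l, (X : ℝ[X]) ^ d l • (!![E 0 l, E 2 l, E 3 l; E 2 l, E 1 l, E 4 l; E 3 l, E 4 l, 0] :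
      Matrix (Fin 3) (Fin 3) ℝ).map C).det).IsRoot t)
    (h : ∃ p q : ℝ, 0 < ((∑ l, E 0 l * t ^ d l) + 2 * p * (∑ l, E 3 l * t ^ d l))
        * ((∑ l, E 1 l * t ^ d l) + 2 * q * (∑ l, E 4 l * t ^ d l))
        - ((∑ l, E 2 l * t ^ d l) + p * (∑ l, E 4 l * t ^ d l) + q * (∑ l, E 3 l * t ^ d l)) ^ 2) :
    (∑ l, E 3 l * t ^ d l) = 0 ∧ (∑ l, E 4 l * t ^ d l) = 0 := by
  by_contra hne
  have huv : (∑ l, E 3 l * t ^ d l) ≠ 0 ∨ (∑ l, E 4 l * t ^ d l) ≠ 0 := by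
    by_contra h'
    push Not at h'
    exact hne h'
  exact det_isoLetters_ne_zero_of_definite_gauge d E t huv h hroot

/-- A `K`-nomial `∑ₗ C(u_l) X^(d l)` is supported on the image of `d`, so it has at most `K` monomials. [folklore] -/
theorem card_support_borderNomial_le {K : ℕ} (d : Fin K → ℕ) (u : Fin K → ℝ) :
    (∑ l, C (u l) * (X : ℝ[X]) ^ d l).support.card ≤ K := by
  classical
  have hsub : (∑ l, C (u l) * (X : ℝ[X]) ^ d l).support ⊆ Finset.univ.image d := by
    intro n hn
    rw [Polynomial.mem_support_iff, Polynomial.finsetSum_coeff] at hn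
    by_contra hnot
    apply hn
    refine Finset.sum_eq_zero fun l _ => ?_
    rw [Polynomial.coeff_C_mul, Polynomial.coeff_X_pow]
    have : n ≠ d l := by
      intro h
      exact hnot (Finset.mem_image.mpr ⟨l, Finset.mem_univ _, h.symm⟩)
    simp [this]
  calc (∑ l, C (u l) * (X : ℝ[X]) ^ d l).support.card ≤ (Finset.univ.image d).card := Finset.card_le_card hsub
    _ ≤ (Finset.univ : Finset (Fin K)).card := Finset.card_image_le
    _ = K := Finset.card_fin K

/-- A non-zero `K`-nomial has at most `K − 1` distinct positive roots (Descartes). [folklore] -/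
theorem card_posRoots_borderNomial_le {K : ℕ} (d : Fin K → ℕ) (u : Fin K → ℝ)
    (hU : (∑ l, C (u l) * (X : ℝ[X]) ^ d l) ≠ 0) :
    ((∑ l, C (u l) * (X : ℝ[X]) ^ d l).roots.toFinset.filter (fun t => 0 < t)).card ≤ K - 1 := by
  have h1 := Literature.Computability.AlgebraicComplexity.card_roots_toFinset_filter_pos_lt_card_support hU
  have h2 := card_support_borderNomial_le d u
  omega

/-- **DEFINITE-GAUGE ROW (all supports, any `K`).**  If an isotropic `(3,K)` pencil admits ONE gauge `(p, q)` whose gauged core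
`(2,K)` pencil is DEFINITE at every `t > 0`, and its border nomial `U` is not the zero polynomial, then the pencil has at most
`K − 1` distinct positive det-roots (every positive det-root is a common zero of `U` and `V`).  At `K = 4`: `≤ 3 < 18`. [folklore] -/
theorem card_posRoots_isoLetters_le_of_definite_gauge {K : ℕ} (d : Fin K → ℕ) (E : Fin 5 → Fin K → ℝ) (p q : ℝ)
    (hdef : ∀ t : ℝ, 0 < t → 0 < ((∑ l, E 0 l * t ^ d l) + 2 * p * (∑ l, E 3 l * t ^ d l))
        * ((∑ l, E 1 l * t ^ d l) + 2 * q * (∑ l, E 4 l * t ^ d l))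
        - ((∑ l, E 2 l * t ^ d l) + p * (∑ l, E 4 l * t ^ d l) + q * (∑ l, E 3 l * t ^ d l)) ^ 2)
    (hU : (∑ l, C (E 3 l) * (X : ℝ[X]) ^ d l) ≠ 0) :
    (((∑ l, (X : ℝ[X]) ^ d l • (!![E 0 l, E 2 l, E 3 l; E 2 l, E 1 l, E 4 l; E 3 l, E 4 l, 0] :
      Matrix (Fin 3) (Fin 3) ℝ).map C).det).roots.toFinset.filter (fun t => 0 < t)).card ≤ K - 1 := by
  classical
  set F : ℝ[X] := (∑ l, (X : ℝ[X]) ^ d l • (!![E 0 l, E 2 l, E 3 l; E 2 l, E 1 l, E 4 l; E 3 l, E 4 l, 0] :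
      Matrix (Fin 3) (Fin 3) ℝ).map C).det with hF
  set U : ℝ[X] := ∑ l, C (E 3 l) * (X : ℝ[X]) ^ d l with hUdef
  refine le_trans (Finset.card_le_card ?_) (card_posRoots_borderNomial_le d (E 3) hU)
  intro t ht
  rw [Finset.mem_filter, Multiset.mem_toFinset] at ht ⊢
  obtain ⟨hmem, htpos⟩ := ht
  have hF0 : F ≠ 0 := by
    intro h0
    rw [h0, Polynomial.roots_zero] at hmem
    exact (Multiset.notMem_zero t) hmem
  have hroot : F.IsRoot t := (Polynomial.mem_roots hF0).mp hmem
  have hb := border_eq_zero_of_isRoot_of_definite_gauge d E t hroot ⟨p, q, hdef t htpos⟩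
  refine ⟨(Polynomial.mem_roots hU).mpr ?_, htpos⟩
  rw [Polynomial.IsRoot, eval_nodePoly]
  exact hb.1

end Summit.ValiantsHypothesis.ValiantsHypothesis.Theorems.LacunarySymmetroidMatrixDescartes.Census
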